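import Mathlib
import Summits.NavierStokesRegularity.NavierStokesRegularity.Theorems.EulerZoomLiouvillePowerGaugeEulerLiouvilleSelfSimilarBernoulliSqueezePressureThinTools
import HarnessLib

/-!
# «PRESSURE SPIKES COST ENSTROPHY»: the high Bernoulli sets of a class profile are SOBOLEV-THIN with NO pressure clause, and the vortical
# (C2) squeeze holds with the rate threshold `1/((2+ρ)(1+ρ))`
# (crux `EulerZoomLiouville.PowerGaugeEulerLiouville` = stmt-NavierStokesRegularity-19832, line `birth`, THE ONE STATEMENT)

Route №10 `EulerZoomLiouville` (NavierStokesRegularity); LEAD ns-typeII-p2 g12.  Sequel of the LEAD's `…SqueezeSobolev` (g11, p636011: the FAST set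
`{‖V y‖ ≥ a‖y‖}` is thin with rate `m = 3+3ρ` by the `E`-gauge and GNS) and `…SqueezeSobolevMember` (g12, p637250: the vortical squeeze with threshold
`1/((2+ρ)(1+ρ))` UNDER the unpressurised clause `P′ ≤ ε‖y‖²`).  Here the unpressurised clause is REMOVED:

* (tools in `…SqueezePressureThinTools`: the pressure-gradient bound from the profile equation, scalar GNS on a cut-off copy, the PRIOR Chebyshev thinness
  `vol({κL² < P′} ∩ B_{5L}) ≤ C_P L^{−1−2ρ}` from the weighted `D`-datum and the bridge `P = P′ + c₀` a.e., the `C¹` truncation `g` of `P′` at height `A = κL²`);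
* **`volume_pressureHigh_inter_closedBall_le_sobolev`** — THE BOOTSTRAP «PRESSURE SPIKES COST ENSTROPHY»: GNS for `χ_L g` gives
  `A⁶ vol({2A ≤ P′} ∩ B̄_{2L}) ≤ C_GNS⁶ (2∫_{B_{5L}}|∇g|² + 2(M/L)²∫_{B_{5L}} g²)³ ≲ (L^{3−ρ})³` (the gradient term by the `A`- and `E`-gauges and linear growth, the
  mass term by the prior thinness), i.e. `vol ≤ K L^{−3−3ρ}`: the pressurised set is thin with the SOBOLEV rate `3+3ρ` instead of the Chebyshev rate `1+2ρ`;
* **`volume_bernoulliHigh_inter_far_le_sobolev`** — hence every high set `{ℋ_{P′} > h}` is thin with rate `3+3ρ` (a far high point is fast or pressurised,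
  ns-ezl-w5's `Loc.norm_ge_of_bernoulliHigh_of_pressure_le`), NO pressure clause;
* **`selfSimilar_ae_eq_zero_of_vorticalFastChannelC2_profile_sharp`** — MEMBER LEVEL, crux hypotheses verbatim (`0 < ρ ≤ ½`): exactly self-similar, `V ∈ C²`
  of linear growth `‖V y‖ ≤ K₁(1+‖y‖)`, and for every classical pressure `P′` and level `h` a radius beyond which every VORTICAL point of `{ℋ_{P′} > h}` has
  `⟪y, γy + V y⟫ ≤ −c₁‖y‖²`, with ONE rate `c₁ > 1/((2+ρ)(1+ρ))` ⇒ `u = 0` a.e.  SUPERSEDES ns-ezl-w5 g0's `…vorticalSuperFastChannelC2_profile` (threshold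
  `3/((2+ρ)(1+2ρ))`, p635682) AND the LEAD's `…_sobolev` (unpressurised clause, p637250).  Portrait consequence for THE ONE STATEMENT: RADIAL Bernoulli-high
  channels (`s − γ ≥ √(γ(1−γ))`, p624179) are dead outright — pressurised or not — since `√(γ(1−γ))(2+ρ)(1+ρ) = (1+ρ)^{3/2} > 1`; the surviving needles have
  NON-RADIAL vortical high sets (large tangential speed or outward high jets: `−⟪y, Vy⟫ < (γ + c₁)‖y‖²` at vortical high points beyond every radius for every
  `c₁ > 1/((2+ρ)(1+ρ))`) or super-linear growth of `V`.

HONEST LABEL: PARTIAL model-class stratum (linear growth, uniformly fast vortical high set).  WHAT THIS IS NOT: not NS, not E — a classical sub-stratum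
`--supports` stmt-19832 on the MODEL lattice; 19832 OPEN; NS regularity NOT proved. [folklore; ConstantinIgnatovaVicol2026Putative §3.2 (3.3), §3.4.3 (3.30);
Gagliardo–Nirenberg–Sobolev inequality]
-/

noncomputable section

-- flat `Theorems/<Route><Decl>…` files of one crux share the namespace of the crux (tree convention)
set_option linter.dupNamespace false

open MeasureTheory Set Filter Topology Metric Function InnerProductSpace
open scoped RealInnerProductSpace NNReal ENNReal ContDiff

namespace Summit.NavierStokesRegularity.NavierStokesRegularity.Theorems.PowerGaugeEulerLiouville.Loc

open Literature.Analysis Literature.Analysis.FluidPDE Literature.Analysis.FunctionSpaces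
open Summit.NavierStokesRegularity.NavierStokesRegularity.Theorems.PowerGaugeEulerLiouville.BernoulliThinness

/-- **THE PRESSURISED SET OF A CLASS PROFILE IS SOBOLEV-THIN** (`0 < ρ < 1`, `γ = 1/(2+ρ)`).  Let `(V, P′)` be a CIV profile with linear growth
`‖V y‖ ≤ K₁(1+‖y‖)` and the class growths `∫_{B_L}|V|² ≤ c_A L^{1−2ρ}`, `∫_{B_L}‖∇V‖² ≤ c_E L^{1−ρ}` (`L > 0`), and suppose the PRIOR thinness
`vol({κL² < P′} ∩ B_{5L}) ≤ C_P L^{−1−2ρ}` for `L ≥ L₁ ≥ 1`.  Then `vol({2κL² ≤ P′} ∩ B̄_{2L}) ≤ K L^{−3−3ρ}` for `L ≥ L₁`.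
Proof: GNS `p = 2, p* = 6` for `χ_L · g`, `g` the truncation of `P′` at height `A = κL²` (`exists_truncation`): `|∇g| ≤ D|∇P′| ≤ D[(1−γ)|V| + (γ+K₁)(1+5L)|∇V|]`
on `B_{5L}` (profile equation), `∫_{B_{5L}} g² ≤ A²·C_P L^{−1−2ρ}`, and `g = A` on the target set — so `A⁶·vol ≲ (L^{3−ρ})³`: PRESSURE SPIKES COST ENSTROPHY.
[folklore; GNS inequality] -/
theorem volume_pressureHigh_inter_closedBall_le_sobolev {ρ : ℝ} (hρ : 0 < ρ) (hρ1 : ρ < 1)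
    {V : EuclideanSpace ℝ (Fin 3) → EuclideanSpace ℝ (Fin 3)} {P' : EuclideanSpace ℝ (Fin 3) → ℝ}
    (hprof : IsSelfSimilarEulerProfile (1 / (2 + ρ)) 0 V P')
    {K₁ : ℝ} (hK₁ : ∀ y : EuclideanSpace ℝ (Fin 3), ‖V y‖ ≤ K₁ * (1 + ‖y‖)) {cA cE : ℝ} (hcA : 0 ≤ cA) (hcE : 0 ≤ cE)
    (hA : ∀ L : ℝ, 0 < L → ∫⁻ y in ball (0 : EuclideanSpace ℝ (Fin 3)) L, ‖V y‖ₑ ^ 2 ≤ ENNReal.ofReal (cA * L ^ (1 - 2 * ρ)))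
    (hE : ∀ L : ℝ, 0 < L → ∫⁻ y in ball (0 : EuclideanSpace ℝ (Fin 3)) L, ‖fderiv ℝ V y‖ₑ ^ 2 ≤
      ENNReal.ofReal (cE * L ^ (1 - ρ)))
    {κ CP L₁ : ℝ} (hκ : 0 < κ) (hCP : 0 ≤ CP) (hL₁ : 1 ≤ L₁)
    (hprior : ∀ L : ℝ, L₁ ≤ L →
      volume ({y : EuclideanSpace ℝ (Fin 3) | κ * L ^ 2 < P' y} ∩ ball (0 : EuclideanSpace ℝ (Fin 3)) (5 * L)) ≤
        ENNReal.ofReal (CP * L ^ (-1 - 2 * ρ))) :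
    ∃ K : ℝ, 0 ≤ K ∧ ∀ L : ℝ, L₁ ≤ L →
      volume ({y : EuclideanSpace ℝ (Fin 3) | 2 * (κ * L ^ 2) ≤ P' y} ∩ closedBall (0 : EuclideanSpace ℝ (Fin 3)) (2 * L)) ≤
        ENNReal.ofReal (K * L ^ (-3 - 3 * ρ)) := by
  have h2ρ : (0 : ℝ) < 2 + ρ := by linarith
  have hγ0 : (0 : ℝ) ≤ 1 / (2 + ρ) := by positivity
  have hγ1 : 1 / (2 + ρ) ≤ 1 := by rw [div_le_one h2ρ]; linarith
  have hK₁0 : 0 ≤ K₁ := by have := hK₁ 0; simp at this; exact (norm_nonneg _).trans this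
  obtain ⟨M, hM0, hcut⟩ := exists_scaledCutoff
  obtain ⟨D, hD0, htrunc⟩ := exists_truncation
  set Cr : ℝ := ((eLpNormLESNormFDerivOfEqInnerConst (volume : Measure (EuclideanSpace ℝ (Fin 3))) 2 : ℝ≥0) : ℝ) with hCr
  have hCr0 : 0 ≤ Cr := NNReal.coe_nonneg _
  set Z : ℝ := (2 * (2 * D ^ 2 * (1 - 1 / (2 + ρ)) ^ 2 * (cA * 5 ^ (1 - 2 * ρ)) +
      2 * D ^ 2 * (1 / (2 + ρ) + K₁) ^ 2 * 36 * (cE * 5 ^ (1 - ρ))) + 2 * (M ^ 2 * κ ^ 2 * CP)) with hZ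
  have hZ0 : 0 ≤ Z := by positivity
  refine ⟨Cr ^ 6 * Z ^ 3 / κ ^ 6, by positivity, fun L hL => ?_⟩
  have hL1 : 1 ≤ L := hL₁.trans hL
  have hL0 : 0 < L := one_pos.trans_le hL1
  have h5L : 0 < 5 * L := by positivity
  set A : ℝ := κ * L ^ 2 with hAdef
  have hA0 : 0 < A := by positivity
  obtain ⟨χ, hχ1, hχc, h0, h1, hone, hzero, hdχ⟩ := hcut L hL0
  obtain ⟨g, hg1, hg_nonneg, hg_le, hg_zero, hg_top, hdg⟩ := htrunc A hA0 P' hprof.contDiff_pressure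
  -- ### `X = ∫_{B_{5L}} ‖∇g‖²`
  obtain ⟨c₁, hc₁⟩ : ∃ c : ℝ, c = 2 * D ^ 2 * (1 - 1 / (2 + ρ)) ^ 2 := ⟨_, rfl⟩
  obtain ⟨c₂, hc₂⟩ : ∃ c : ℝ, c = 2 * D ^ 2 * (1 / (2 + ρ) + K₁) ^ 2 * (1 + 5 * L) ^ 2 := ⟨_, rfl⟩
  have hc₁0 : 0 ≤ c₁ := by rw [hc₁]; positivity
  have hc₂0 : 0 ≤ c₂ := by rw [hc₂]; positivity
  obtain ⟨Xb, hXb⟩ : ∃ x : ℝ, x = c₁ * (cA * (5 * L) ^ (1 - 2 * ρ)) + c₂ * (cE * (5 * L) ^ (1 - ρ)) := ⟨_, rfl⟩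
  have hXb0 : 0 ≤ Xb := by rw [hXb]; positivity
  have hmeasV : Measurable fun y => ENNReal.ofReal c₁ * ‖V y‖ₑ ^ 2 :=
    (hprof.contDiff_velocity.continuous.measurable.enorm.pow_const 2).const_mul _
  have hpt : ∀ y ∈ ball (0 : EuclideanSpace ℝ (Fin 3)) (5 * L),
      ‖fderiv ℝ g y‖ₑ ^ 2 ≤ ENNReal.ofReal c₁ * ‖V y‖ₑ ^ 2 + ENNReal.ofReal c₂ * ‖fderiv ℝ V y‖ₑ ^ 2 := by
    intro y hy
    have h := enorm_fderiv_truncation_sq_le hγ0 hγ1 hprof hK₁0 hK₁ hD0 hdg hL0 (mem_ball_zero_iff.1 hy)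
    rw [← hc₁, ← hc₂] at h
    exact h
  have hi1 : (∫⁻ y in ball (0 : EuclideanSpace ℝ (Fin 3)) (5 * L), ENNReal.ofReal c₁ * ‖V y‖ₑ ^ 2) =
      ENNReal.ofReal c₁ * ∫⁻ y in ball (0 : EuclideanSpace ℝ (Fin 3)) (5 * L), ‖V y‖ₑ ^ 2 :=
    lintegral_const_mul' _ _ ENNReal.ofReal_ne_top
  have hi2 : (∫⁻ y in ball (0 : EuclideanSpace ℝ (Fin 3)) (5 * L), ENNReal.ofReal c₂ * ‖fderiv ℝ V y‖ₑ ^ 2) =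
      ENNReal.ofReal c₂ * ∫⁻ y in ball (0 : EuclideanSpace ℝ (Fin 3)) (5 * L), ‖fderiv ℝ V y‖ₑ ^ 2 :=
    lintegral_const_mul' _ _ ENNReal.ofReal_ne_top
  have hXsplit : ENNReal.ofReal Xb = ENNReal.ofReal c₁ * ENNReal.ofReal (cA * (5 * L) ^ (1 - 2 * ρ)) +
      ENNReal.ofReal c₂ * ENNReal.ofReal (cE * (5 * L) ^ (1 - ρ)) := by
    rw [hXb, ENNReal.ofReal_add (by positivity) (by positivity), ENNReal.ofReal_mul hc₁0, ENNReal.ofReal_mul hc₂0]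
  have hX : ∫⁻ y in ball (0 : EuclideanSpace ℝ (Fin 3)) (5 * L), ‖fderiv ℝ g y‖ₑ ^ 2 ≤ ENNReal.ofReal Xb := by
    calc ∫⁻ y in ball (0 : EuclideanSpace ℝ (Fin 3)) (5 * L), ‖fderiv ℝ g y‖ₑ ^ 2
        ≤ ∫⁻ y in ball (0 : EuclideanSpace ℝ (Fin 3)) (5 * L), (ENNReal.ofReal c₁ * ‖V y‖ₑ ^ 2 + ENNReal.ofReal c₂ * ‖fderiv ℝ V y‖ₑ ^ 2) :=
          setLIntegral_mono' measurableSet_ball hpt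
      _ = (ENNReal.ofReal c₁ * ∫⁻ y in ball (0 : EuclideanSpace ℝ (Fin 3)) (5 * L), ‖V y‖ₑ ^ 2) +
            ENNReal.ofReal c₂ * ∫⁻ y in ball (0 : EuclideanSpace ℝ (Fin 3)) (5 * L), ‖fderiv ℝ V y‖ₑ ^ 2 := by
          rw [lintegral_add_left' hmeasV.aemeasurable, hi1, hi2]
      _ ≤ ENNReal.ofReal c₁ * ENNReal.ofReal (cA * (5 * L) ^ (1 - 2 * ρ)) + ENNReal.ofReal c₂ * ENNReal.ofReal (cE * (5 * L) ^ (1 - ρ)) := by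
          have h1' := hA (5 * L) h5L
          have h2' := hE (5 * L) h5L
          gcongr
      _ = ENNReal.ofReal Xb := hXsplit.symm
  -- ### `Y = ∫_{B_{5L}} g² ≤ A² C_P L^{−1−2ρ}`
  obtain ⟨Yb, hYb⟩ : ∃ x : ℝ, x = A ^ 2 * (CP * L ^ (-1 - 2 * ρ)) := ⟨_, rfl⟩
  have hYb0 : 0 ≤ Yb := by rw [hYb]; positivity
  have hYsplit : ENNReal.ofReal Yb = ENNReal.ofReal (A ^ 2) * ENNReal.ofReal (CP * L ^ (-1 - 2 * ρ)) := by
    rw [hYb, ENNReal.ofReal_mul (by positivity)]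
  have hSo : IsOpen {y : EuclideanSpace ℝ (Fin 3) | A < P' y} := isOpen_lt continuous_const hprof.contDiff_pressure.continuous
  have hY : ∫⁻ y in ball (0 : EuclideanSpace ℝ (Fin 3)) (5 * L), ‖g y‖ₑ ^ 2 ≤ ENNReal.ofReal Yb := by
    have hpw : ∀ y, ‖g y‖ₑ ^ 2 ≤ ({y : EuclideanSpace ℝ (Fin 3) | A < P' y}).indicator (fun _ => ENNReal.ofReal (A ^ 2)) y := by
      intro y
      by_cases hy : A < P' y
      · rw [indicator_of_mem (show y ∈ {y : EuclideanSpace ℝ (Fin 3) | A < P' y} from hy), ← ofReal_norm,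
          ← ENNReal.ofReal_pow (norm_nonneg _), Real.norm_of_nonneg (hg_nonneg y)]
        exact ENNReal.ofReal_le_ofReal (pow_le_pow_left₀ (hg_nonneg y) (hg_le y) 2)
      · rw [hg_zero y (not_lt.1 hy)]
        simp
    calc ∫⁻ y in ball (0 : EuclideanSpace ℝ (Fin 3)) (5 * L), ‖g y‖ₑ ^ 2
        ≤ ∫⁻ y in ball (0 : EuclideanSpace ℝ (Fin 3)) (5 * L), ({y : EuclideanSpace ℝ (Fin 3) | A < P' y}).indicator (fun _ => ENNReal.ofReal (A ^ 2)) y :=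
          lintegral_mono hpw
      _ = ENNReal.ofReal (A ^ 2) * volume ({y : EuclideanSpace ℝ (Fin 3) | A < P' y} ∩ ball (0 : EuclideanSpace ℝ (Fin 3)) (5 * L)) := by
          rw [lintegral_indicator hSo.measurableSet, setLIntegral_const, Measure.restrict_apply hSo.measurableSet]
      _ ≤ ENNReal.ofReal (A ^ 2) * ENNReal.ofReal (CP * L ^ (-1 - 2 * ρ)) := by
          have h1' := hprior L hL
          gcongr
      _ = ENNReal.ofReal Yb := hYsplit.symm
  -- ### GNS and the inner bound
  have hI6 := lintegral_pow_six_le_of_cutoff_real hg1 hχ1 hχc h1 h0 hL0 hone hzero hdχ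
  obtain ⟨m2, hm2⟩ : ∃ x : ℝ, x = (M / L) ^ 2 := ⟨_, rfl⟩
  have hm20 : 0 ≤ m2 := by rw [hm2]; positivity
  rw [← hm2] at hI6
  have hbook := bootstrap_bookkeeping (D := D) (γ := 1 / (2 + ρ)) (K₁ := K₁) (M := M) (κ := κ) (by linarith : (-2 : ℝ) ≤ ρ) hL1 hcA hcE hCP
  have hbook' : 2 * Xb + 2 * m2 * Yb ≤ Z * L ^ (3 - ρ) := by
    rw [hXb, hYb, hm2, hc₁, hc₂, hAdef, hZ]
    exact hbook
  have hsum : ENNReal.ofReal (2 * Xb + 2 * m2 * Yb) = 2 * ENNReal.ofReal Xb + 2 * ENNReal.ofReal m2 * ENNReal.ofReal Yb := by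
    rw [ENNReal.ofReal_add (by positivity : (0:ℝ) ≤ 2 * Xb) (by positivity : (0:ℝ) ≤ 2 * m2 * Yb),
      ENNReal.ofReal_mul (by norm_num : (0:ℝ) ≤ 2), ENNReal.ofReal_mul (by positivity : (0:ℝ) ≤ 2 * m2),
      ENNReal.ofReal_mul (by norm_num : (0:ℝ) ≤ 2), ENNReal.ofReal_ofNat]
  have hinner : (2 * ∫⁻ y in ball (0 : EuclideanSpace ℝ (Fin 3)) (5 * L), ‖fderiv ℝ g y‖ₑ ^ 2) +
      2 * ENNReal.ofReal m2 * ∫⁻ y in ball (0 : EuclideanSpace ℝ (Fin 3)) (5 * L), ‖g y‖ₑ ^ 2 ≤ ENNReal.ofReal (Z * L ^ (3 - ρ)) := by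
    calc (2 * ∫⁻ y in ball (0 : EuclideanSpace ℝ (Fin 3)) (5 * L), ‖fderiv ℝ g y‖ₑ ^ 2) +
          2 * ENNReal.ofReal m2 * ∫⁻ y in ball (0 : EuclideanSpace ℝ (Fin 3)) (5 * L), ‖g y‖ₑ ^ 2
        ≤ 2 * ENNReal.ofReal Xb + 2 * ENNReal.ofReal m2 * ENNReal.ofReal Yb := by
          gcongr
      _ = ENNReal.ofReal (2 * Xb + 2 * m2 * Yb) := hsum.symm
      _ ≤ ENNReal.ofReal (Z * L ^ (3 - ρ)) := ENNReal.ofReal_le_ofReal hbook'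
  -- ### Chebyshev on the target set
  set T : Set (EuclideanSpace ℝ (Fin 3)) := {y | 2 * (κ * L ^ 2) ≤ P' y} ∩ closedBall (0 : EuclideanSpace ℝ (Fin 3)) (2 * L) with hT
  have hTm : MeasurableSet T :=
    (isClosed_le continuous_const hprof.contDiff_pressure.continuous).measurableSet.inter measurableSet_closedBall
  have hA6 : 0 < A ^ 6 := by positivity
  have hcheb : ENNReal.ofReal (A ^ 6) * volume T ≤ ENNReal.ofReal (Cr ^ 6 * (Z * L ^ (3 - ρ)) ^ 3) := by
    calc ENNReal.ofReal (A ^ 6) * volume T = ∫⁻ _ in T, ENNReal.ofReal (A ^ 6) := (setLIntegral_const T _).symm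
      _ ≤ ∫⁻ y in T, ‖g y‖ₑ ^ 6 := by
          refine lintegral_mono_ae ((ae_restrict_iff' hTm).2 (Eventually.of_forall fun y hy => ?_))
          obtain ⟨hyP, -⟩ := hy
          rw [← ofReal_norm, ← ENNReal.ofReal_pow (norm_nonneg _), Real.norm_of_nonneg (hg_nonneg y), hg_top y hyP]
      _ ≤ ∫⁻ y in closedBall (0 : EuclideanSpace ℝ (Fin 3)) (2 * L), ‖g y‖ₑ ^ 6 := lintegral_mono_set inter_subset_right
      _ ≤ (eLpNormLESNormFDerivOfEqInnerConst (volume : Measure (EuclideanSpace ℝ (Fin 3))) 2 : ℝ≥0∞) ^ 6 *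
            ((2 * ∫⁻ y in ball (0 : EuclideanSpace ℝ (Fin 3)) (5 * L), ‖fderiv ℝ g y‖ₑ ^ 2) +
              2 * ENNReal.ofReal m2 * ∫⁻ y in ball (0 : EuclideanSpace ℝ (Fin 3)) (5 * L), ‖g y‖ₑ ^ 2) ^ 3 := hI6
      _ ≤ (eLpNormLESNormFDerivOfEqInnerConst (volume : Measure (EuclideanSpace ℝ (Fin 3))) 2 : ℝ≥0∞) ^ 6 *
            (ENNReal.ofReal (Z * L ^ (3 - ρ))) ^ 3 := by
          gcongr
      _ = ENNReal.ofReal (Cr ^ 6 * (Z * L ^ (3 - ρ)) ^ 3) := by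
          have hZL : 0 ≤ Z * L ^ (3 - ρ) := by positivity
          rw [ENNReal.ofReal_mul (pow_nonneg hCr0 6), ENNReal.ofReal_pow hCr0, ENNReal.ofReal_pow hZL, hCr,
            ENNReal.ofReal_coe_nnreal]
  have hvol : volume T ≤ ENNReal.ofReal (Cr ^ 6 * (Z * L ^ (3 - ρ)) ^ 3) / ENNReal.ofReal (A ^ 6) := by
    rw [ENNReal.le_div_iff_mul_le (Or.inl ((ENNReal.ofReal_pos.2 hA6).ne')) (Or.inl ENNReal.ofReal_ne_top), mul_comm]
    exact hcheb
  refine hvol.trans ?_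
  rw [← ENNReal.ofReal_div_of_pos hA6, hAdef, bootstrap_exponent hL0 hκ]

/-! ### The high Bernoulli sets are Sobolev-thin — no pressure clause -/

/-- **THE HIGH BERNOULLI SETS OF A CLASS PROFILE ARE SOBOLEV-THIN, WITH NO PRESSURE CLAUSE** (`0 < ρ < 1`, `γ = 1/(2+ρ)`).  For a CIV profile `(V, P′)` of
linear growth with the class growths of `|V|²` and `‖∇V‖²`, whose classical pressure is the member's pressure profile up to a constant (`P = P′ + c₀` a.e.,
`P` carrying the weighted `D`-datum), every level `h` has `C, R₂ > 0` with `vol({ℋ_{P′} > h} ∩ {‖y‖ ≥ R}) ≤ C R^{−(3+3ρ)}` for `R ≥ R₂`: a far high point is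
either FAST (`‖V y‖ ≥ a_γ‖y‖`, Sobolev-thin by `Loc.volume_fastSet_inter_shell_le_sobolev`) or PRESSURISED (`P′(y) > (γ(1−2γ)/4)‖y‖²`, Sobolev-thin by
`volume_pressureHigh_inter_closedBall_le_sobolev`). [folklore; GNS inequality] -/
theorem volume_bernoulliHigh_inter_far_le_sobolev {ρ : ℝ} (hρ : 0 < ρ) (hρ1 : ρ < 1)
    {V : EuclideanSpace ℝ (Fin 3) → EuclideanSpace ℝ (Fin 3)} {P' : EuclideanSpace ℝ (Fin 3) → ℝ}
    (hprof : IsSelfSimilarEulerProfile (1 / (2 + ρ)) 0 V P')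
    {K₁ : ℝ} (hK₁ : ∀ y : EuclideanSpace ℝ (Fin 3), ‖V y‖ ≤ K₁ * (1 + ‖y‖)) {cA cE : ℝ} (hcA : 0 ≤ cA) (hcE : 0 ≤ cE)
    (hA : ∀ L : ℝ, 0 < L → ∫⁻ y in ball (0 : EuclideanSpace ℝ (Fin 3)) L, ‖V y‖ₑ ^ 2 ≤ ENNReal.ofReal (cA * L ^ (1 - 2 * ρ)))
    (hE : ∀ L : ℝ, 0 < L → ∫⁻ y in ball (0 : EuclideanSpace ℝ (Fin 3)) L, ‖fderiv ℝ V y‖ₑ ^ 2 ≤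
      ENNReal.ofReal (cE * L ^ (1 - ρ)))
    {P : EuclideanSpace ℝ (Fin 3) → ℝ} (hPm : AEStronglyMeasurable P volume) {CD : ℝ}
    (hD : ∫⁻ y, ‖P y‖ₑ ^ (3 / 2 : ℝ) * ENNReal.ofReal (‖y‖ ^ (2 * ρ - 2)) ≤ ENNReal.ofReal CD)
    {c₀ : ℝ} (hc₀ : P =ᵐ[volume] fun y => P' y + c₀) (h : ℝ) :
    ∃ C R₂ : ℝ, 0 < R₂ ∧ ∀ R : ℝ, R₂ ≤ R →
      volume ({y : EuclideanSpace ℝ (Fin 3) | h < selfSimilarBernoulli (1 / (2 + ρ)) 0 V P' y} ∩ {y | R ≤ ‖y‖}) ≤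
        ENNReal.ofReal (C * R ^ (-(3 + 3 * ρ))) := by
  have h2ρ : (0 : ℝ) < 2 + ρ := by linarith
  have hγ : (0 : ℝ) < 1 / (2 + ρ) := one_div_pos.2 h2ρ
  have hγ2 : 1 / (2 + ρ) < 1 / 2 := one_div_lt_one_div_of_lt two_pos (by linarith)
  have hV1 : ContDiff ℝ 1 V := hprof.contDiff_velocity.of_le (by norm_num)
  -- the fast part
  set a : ℝ := (Real.sqrt ((1 / (2 + ρ)) / 2) - 1 / (2 + ρ)) / 2 with hadef
  have hsq : 1 / (2 + ρ) < Real.sqrt ((1 / (2 + ρ)) / 2) := by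
    rw [Real.lt_sqrt hγ.le]; nlinarith
  have ha : 0 < a := by rw [hadef]; linarith
  obtain ⟨Kf, hKf0, hfast⟩ := volume_fastSet_inter_shell_le_sobolev (by linarith : (-2 : ℝ) ≤ ρ) hV1 hcA hcE hA hE ha
  -- the pressurised part
  set d : ℝ := (1 / (2 + ρ)) * (1 - 2 * (1 / (2 + ρ))) / 4 with hddef
  have hd : 0 < d := by
    rw [hddef]
    have : 0 < 1 - 2 * (1 / (2 + ρ)) := by linarith
    positivity
  have hκ : 0 < d / 2 := by positivity
  obtain ⟨CP, L₁, hCP, hL₁, hprior⟩ :=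
    volume_pressureHigh_inter_ball_le_prior hρ1 hPm hD hprof.contDiff_pressure.continuous hc₀ hκ
  obtain ⟨KP, hKP0, hpress⟩ := volume_pressureHigh_inter_closedBall_le_sobolev hρ hρ1 hprof hK₁ hcA hcE hA hE hκ hCP hL₁ hprior
  -- pointwise: a far high point with small pressure is fast
  obtain ⟨R₃, hR₃⟩ := norm_ge_of_bernoulliHigh_of_pressure_le hγ hγ2 V P' h
  -- the shell bound
  set L₀ : ℝ := max L₁ (max R₃ 1) with hL₀
  have hL₀pos : 0 < L₀ := lt_of_lt_of_le one_pos ((le_max_right _ _).trans (le_max_right _ _))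
  have hs : (-3 - 3 * ρ : ℝ) < 0 := by linarith
  have hshell : ∀ L : ℝ, L₀ ≤ L →
      volume ({y : EuclideanSpace ℝ (Fin 3) | h < selfSimilarBernoulli (1 / (2 + ρ)) 0 V P' y} ∩ {y | L ≤ ‖y‖ ∧ ‖y‖ ≤ 2 * L}) ≤
        ENNReal.ofReal ((Kf + KP) * L ^ (-3 - 3 * ρ)) := by
    intro L hL
    have hLL₁ : L₁ ≤ L := (le_max_left _ _).trans hL
    have hLR₃ : R₃ ≤ L := ((le_max_left _ _).trans (le_max_right _ _)).trans hL
    have hL1 : 1 ≤ L := ((le_max_right _ _).trans (le_max_right _ _)).trans hL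
    have hL0 : 0 < L := one_pos.trans_le hL1
    have hsplit : {y : EuclideanSpace ℝ (Fin 3) | h < selfSimilarBernoulli (1 / (2 + ρ)) 0 V P' y} ∩ {y | L ≤ ‖y‖ ∧ ‖y‖ ≤ 2 * L} ⊆
        ({y : EuclideanSpace ℝ (Fin 3) | a * ‖y‖ ≤ ‖V y‖} ∩ {y | L ≤ ‖y‖ ∧ ‖y‖ ≤ 2 * L}) ∪
          ({y : EuclideanSpace ℝ (Fin 3) | 2 * (d / 2 * L ^ 2) ≤ P' y} ∩ closedBall (0 : EuclideanSpace ℝ (Fin 3)) (2 * L)) := by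
      rintro y ⟨hy, hyL, hy2L⟩
      by_cases hP : P' y ≤ d * ‖y‖ ^ 2
      · exact Or.inl ⟨hR₃ y (hLR₃.trans hyL) hP hy, hyL, hy2L⟩
      · right
        refine ⟨?_, mem_closedBall_zero_iff.2 hy2L⟩
        push Not at hP
        have hdL : d * L ^ 2 ≤ d * ‖y‖ ^ 2 := mul_le_mul_of_nonneg_left (pow_le_pow_left₀ hL0.le hyL 2) hd.le
        show 2 * (d / 2 * L ^ 2) ≤ P' y
        linarith
    calc volume ({y : EuclideanSpace ℝ (Fin 3) | h < selfSimilarBernoulli (1 / (2 + ρ)) 0 V P' y} ∩ {y | L ≤ ‖y‖ ∧ ‖y‖ ≤ 2 * L})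
        ≤ volume ({y : EuclideanSpace ℝ (Fin 3) | a * ‖y‖ ≤ ‖V y‖} ∩ {y | L ≤ ‖y‖ ∧ ‖y‖ ≤ 2 * L}) +
            volume ({y : EuclideanSpace ℝ (Fin 3) | 2 * (d / 2 * L ^ 2) ≤ P' y} ∩ closedBall (0 : EuclideanSpace ℝ (Fin 3)) (2 * L)) :=
          (measure_mono hsplit).trans (measure_union_le _ _)
      _ ≤ ENNReal.ofReal (Kf * L ^ (-3 - 3 * ρ)) + ENNReal.ofReal (KP * L ^ (-3 - 3 * ρ)) := add_le_add (hfast L hL1) (hpress L hLL₁)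
      _ = ENNReal.ofReal ((Kf + KP) * L ^ (-3 - 3 * ρ)) := by
          rw [← ENNReal.ofReal_add (by positivity) (by positivity)]; congr 1; ring
  refine ⟨|Kf + KP| * (1 - (2 : ℝ) ^ (-3 - 3 * ρ))⁻¹, L₀, hL₀pos, fun R hR => ?_⟩
  rw [show (-(3 + 3 * ρ) : ℝ) = -3 - 3 * ρ by ring]
  exact volume_inter_far_le_of_shell _ hL₀pos hs hshell hR

/-! ### Member level: the vortical squeeze with the Sobolev threshold, no pressure clause -/

/-- **EXACTLY SELF-SIMILAR MEMBERS WHOSE `C²` PROFILE OF LINEAR GROWTH HAS A FAR VORTICAL CHANNEL OF RATE `c₁ > 1/((2+ρ)(1+ρ))` ARE TRIVIAL — NO PRESSURE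
CLAUSE** (crux hypotheses verbatim, `0 < ρ ≤ ½`, `γ = 1/(2+ρ)`; `V ∈ C²`, `‖V y‖ ≤ K₁(1+‖y‖)`; for every classical pressure `P′` of `V` and every level `h` a
radius beyond which every VORTICAL point of `{ℋ_{P′} > h}` has `⟪y, γy + V y⟫ ≤ −c₁‖y‖²`).  The high sets are Sobolev-thin with rate `m = 3+3ρ`
(`volume_bernoulliHigh_inter_far_le_sobolev`: fast points by the `E`-gauge, pressurised points because PRESSURE SPIKES COST ENSTROPHY), the race is
`3γ < c₁(3+3ρ) ⟺ c₁(2+ρ)(1+ρ) > 1`, then ns-ezl-w5's squeeze `Loc.curl_eq_zero_of_vorticalFastChannel_of_thin` and the irrotational `C²` stratum.  This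
SUPERSEDES both `Loc.selfSimilar_ae_eq_zero_of_vorticalSuperFastChannelC2_profile` (threshold `3/((2+ρ)(1+2ρ))`) and
`Loc.selfSimilar_ae_eq_zero_of_vorticalFastChannelC2_profile_sobolev` (unpressurised clause). [folklore; ConstantinIgnatovaVicol2026Putative §3.4.3 (3.30); GNS inequality] -/
theorem selfSimilar_ae_eq_zero_of_vorticalFastChannelC2_profile_sharp {ρ : ℝ} (hρ : 0 < ρ) (hρ1 : ρ ≤ 1 / 2)
    {u : ℝ → EuclideanSpace ℝ (Fin 3) → EuclideanSpace ℝ (Fin 3)} {p : ℝ → EuclideanSpace ℝ (Fin 3) → ℝ}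
    {H : ℝ → EuclideanSpace ℝ (Fin 3) → EuclideanSpace ℝ (Fin 3) →L[ℝ] EuclideanSpace ℝ (Fin 3)} {c : ℝ≥0}
    (hsw : IsSuitableWeakSolutionOn (slab (EuclideanSpace ℝ (Fin 3)) (Iio 0) isOpen_Iio) 0 0 u p)
    (hH : HasWeakSpatialGradientOn (slab (EuclideanSpace ℝ (Fin 3)) (Iio 0) isOpen_Iio) u H)
    (hgauge : ∀ a : ℝ, 0 < a →
      ENNReal.ofReal (a ^ (2 * ρ)) * cknA a (0 : ℝ × EuclideanSpace ℝ (Fin 3)) u +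
          ENNReal.ofReal (a ^ ρ) * cknE a (0 : ℝ × EuclideanSpace ℝ (Fin 3)) H +
        ENNReal.ofReal (a ^ (2 * ρ)) * cknD a (0 : ℝ × EuclideanSpace ℝ (Fin 3)) p ≤ (c : ℝ≥0∞))
    {V : EuclideanSpace ℝ (Fin 3) → EuclideanSpace ℝ (Fin 3)} {P : EuclideanSpace ℝ (Fin 3) → ℝ}
    (hu : ∀ τ : ℝ, τ < 0 → u τ = selfSimilarCollapse (1 / (2 + ρ)) 0 V τ)
    (hp : ∀ τ : ℝ, τ < 0 → p τ = selfSimilarCollapsePressure (1 / (2 + ρ)) 0 P τ)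
    (hV : ContDiff ℝ 2 V) {K₁ : ℝ} (hK₁ : ∀ y : EuclideanSpace ℝ (Fin 3), ‖V y‖ ≤ K₁ * (1 + ‖y‖))
    {c₁ : ℝ} (hc₁ : 1 / ((2 + ρ) * (1 + ρ)) < c₁)
    (hB : ∀ P' : EuclideanSpace ℝ (Fin 3) → ℝ, IsSelfSimilarEulerProfile (1 / (2 + ρ)) 0 V P' →
      ∀ h : ℝ, ∃ R₀ : ℝ, ∀ y : EuclideanSpace ℝ (Fin 3), R₀ ≤ ‖y‖ →
        h < selfSimilarBernoulli (1 / (2 + ρ)) 0 V P' y → curl V y ≠ 0 →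
          ⟪y, selfSimilarTransport (1 / (2 + ρ)) 0 V y⟫ ≤ -(c₁ * ‖y‖ ^ 2)) :
    uncurry u =ᵐ[volume.restrict (Iio (0 : ℝ) ×ˢ (univ : Set (EuclideanSpace ℝ (Fin 3))))] 0 := by
  -- adapted from `Loc.selfSimilar_ae_eq_zero_of_vorticalSuperFastChannelC2_profile` (…SqueezeVorticalMember, ns-ezl-w5 g0)
  have hρ1' : ρ < 1 := by linarith
  have h2ρ : (0 : ℝ) < 2 + ρ := by linarith
  have hγ : (0 : ℝ) < 1 / (2 + ρ) := one_div_pos.2 h2ρ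
  have hγ2 : 1 / (2 + ρ) < 1 / 2 := one_div_lt_one_div_of_lt two_pos (by linarith)
  have hA : ∀ a : ℝ, 0 < a → ENNReal.ofReal (a ^ (2 * ρ)) *
      cknA a (0 : ℝ × EuclideanSpace ℝ (Fin 3)) u ≤ (c : ℝ≥0∞) :=
    fun a ha => le_trans (le_trans le_self_add le_self_add) (hgauge a ha)
  have hD : ∀ a : ℝ, 0 < a → ENNReal.ofReal (a ^ (2 * ρ)) *
      cknD a (0 : ℝ × EuclideanSpace ℝ (Fin 3)) p ≤ (c : ℝ≥0∞) :=
    fun a ha => le_trans le_add_self (hgauge a ha)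
  have hpm : AEStronglyMeasurable (uncurry p)
      (volume.restrict (Iio (0 : ℝ) ×ˢ (univ : Set (EuclideanSpace ℝ (Fin 3))))) := by
    have := hsw.distributional.2.2.1.aestronglyMeasurable
    simpa [slab] using this
  have hPm := aestronglyMeasurable_pressureProfile hpm hp
  have hDprof := profile_pressure_weight_of_gaugeD hρ hρ1' hpm hp hD
  have hP1 : LocallyIntegrable P volume :=
    EnergySaturation.locallyIntegrable_pressure_of_weight hρ1' hPm
      (ENNReal.mul_ne_top ENNReal.ofReal_ne_top ENNReal.coe_ne_top) hDprof
  obtain ⟨P', hprof⟩ := WeakToClassical.exists_isSelfSimilarEulerProfile_of_contDiff hsw.distributional hu hp hV hP1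
  have hfast := hB P' hprof
  -- the bridge: `P = P' + c₀` a.e.
  obtain ⟨c₀, hc₀⟩ := WeakToClassical.pressureProfile_ae_eq_add_const hsw.distributional hu hp hV hP1 hprof
  -- the `A`-, `E`- and `D`-data of the profile
  have hV1 : ContDiff ℝ 1 V := hV.of_le (by norm_num)
  have hin := fun (R : ℝ) (hR : 0 < R) =>
    NeedleThinCore.selfSimilar_shell_inputs hρ hρ1' hsw hH hgauge hu hp hV1 hR
  have hEprof : ∀ L : ℝ, 0 < L → ∫⁻ y in ball (0 : EuclideanSpace ℝ (Fin 3)) L, ‖fderiv ℝ V y‖ₑ ^ 2 ≤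
      ENNReal.ofReal ((1 - ρ) / (2 + ρ) * c * L ^ (1 - ρ)) := fun L hL => (hin L hL).1
  have hAprof : ∀ L : ℝ, 0 < L → ∫⁻ y in ball (0 : EuclideanSpace ℝ (Fin 3)) L, ‖V y‖ₑ ^ 2 ≤
      ENNReal.ofReal (c * L ^ (1 - 2 * ρ)) := fun L hL => (hin L hL).2
  have hcA : (0 : ℝ) ≤ c := NNReal.coe_nonneg c
  have hcE : (0 : ℝ) ≤ (1 - ρ) / (2 + ρ) * c := by
    have : (0 : ℝ) ≤ (1 - ρ) / (2 + ρ) := div_nonneg (by linarith) h2ρ.le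
    exact mul_nonneg this hcA
  have hD' : ∫⁻ y, ‖P y‖ₑ ^ (3 / 2 : ℝ) * ENNReal.ofReal (‖y‖ ^ (2 * ρ - 2)) ≤
      ENNReal.ofReal ((2 - 2 * ρ) / (2 + ρ) * (c : ℝ)) := by
    refine hDprof.trans (le_of_eq ?_)
    rw [ENNReal.ofReal_mul (by apply div_nonneg <;> linarith), ENNReal.ofReal_coe_nnreal]
  -- SOBOLEV THINNESS of the high sets, rate `3 + 3ρ`, no pressure clause
  have hthin : ∀ h : ℝ, ∃ C R₂ : ℝ, 0 < R₂ ∧ ∀ R : ℝ, R₂ ≤ R →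
      volume ({y : EuclideanSpace ℝ (Fin 3) | h < selfSimilarBernoulli (1 / (2 + ρ)) 0 V P' y} ∩ {y | R ≤ ‖y‖}) ≤
        ENNReal.ofReal (C * R ^ (-(3 + 3 * ρ))) := fun h =>
    volume_bernoulliHigh_inter_far_le_sobolev hρ hρ1' hprof hK₁ hcA hcE hAprof hEprof hPm hD' hc₀ h
  -- the race `3γ < c₁ (3 + 3ρ)`, i.e. `1 < c₁ (2+ρ)(1+ρ)`
  have hrace : 3 * (1 / (2 + ρ)) < c₁ * (3 + 3 * ρ) := by
    have h1ρ : (0 : ℝ) < 1 + ρ := by linarith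
    have h1 := (div_lt_iff₀ (by positivity : (0 : ℝ) < (2 + ρ) * (1 + ρ))).1 hc₁
    rw [show 3 * (1 / (2 + ρ)) = 3 / (2 + ρ) by ring, div_lt_iff₀ h2ρ]
    nlinarith
  have hc₁0 : 0 < c₁ := lt_trans (by positivity) hc₁
  have hcurl : ∀ x, curl V x = 0 := fun x =>
    curl_eq_zero_of_vorticalFastChannel_of_thin hprof hγ hγ2 hK₁ hc₁0 hrace hthin hfast x
  exact Loc.selfSimilar_ae_eq_zero_of_irrotationalC2_profile hρ hsw.distributional hA hu hV hcurl

end Summit.NavierStokesRegularity.NavierStokesRegularity.Theorems.PowerGaugeEulerLiouville.Loc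

end
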